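import Summits.BirchSwinnertonDyer.BirchSwinnertonDyer.Theorems.GenusKolyvaginAtTwoPowDvdShaCardAtTwoRTExactSwapCoreFrob
import Summits.BirchSwinnertonDyer.BirchSwinnertonDyer.Theorems.GenusKolyvaginAtTwoPowDvdShaCardAtTwoRTExactSwapHybrid
import Summits.BirchSwinnertonDyer.BirchSwinnertonDyer.Theorems.GenusKolyvaginAtTwoPowDvdShaCardAtTwoRTExactSwapLawKummer
import Summits.BirchSwinnertonDyer.BirchSwinnertonDyer.Theorems.GenusKolyvaginAtTwoPowDvdShaCardAtTwoRTExactSwapLawTransverse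
import Summits.BirchSwinnertonDyer.BirchSwinnertonDyer.Theorems.KolyvaginRankRigidityAtTwoSwapAuxClassGlobalAtTwo
import Summits.BirchSwinnertonDyer.BirchSwinnertonDyer.Theorems.KolyvaginRankRigidityAtTwoSwapWeilDatumLiftChange
import Summits.BirchSwinnertonDyer.Rank1Residual.JET.TransverseFamilyConjAct
import Summits.BirchSwinnertonDyer.BirchSwinnertonDyer.Theorems.KolyvaginRankRigidityAtTwoTransversePackageAtTwo
import Summits.BirchSwinnertonDyer.BirchSwinnertonDyer.Theorems.KolyvaginRankRigidityAtTwoTransverseClassAtTwo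
import Summits.BirchSwinnertonDyer.BirchSwinnertonDyer.Theorems.ByReductionTypeAtTwoRankOneAtTwoBigImageOddLocalOneDoorBottomLemma43AtTwo
import Summits.BirchSwinnertonDyer.BirchSwinnertonDyer.Theorems.KolyvaginRankRigidityAtTwoSwapOfNamedFacts
import HarnessLib

/-!
# Route `GenusKolyvaginAtTwo`, LINE 18 (L_T `PowDvdShaCardAtTwoRT`, stmt-BirchSwinnertonDyer-23242), stub KS — the exact prime swap at 2 on the
# HYBRID transverse frame, Frobenius binder on the swapped-out prime (twin of `…RTExactSwapHybrid` over `exactSwap_core_frob`)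

LEAD seat `bsd-line-gk2-p1` g18 (cell `bsd-f1-sign2`), `--supports stmt-BirchSwinnertonDyer-23242` (helper; closes nothing).  THEOREMS ONLY;
BSD is not proved by any of this; neither is the crux, nor stub KS.

`exactSwap_core_hybrid_frob`: `exactSwap_core_hybrid` VERBATIM except that the displayed sharp upper bound `hP7b` carries gk2-p3 g23's
Frobenius binder (`M ≤ M′ → FrobEqFrobInfty W K (2^M′) q →`; without it the bound is false at a Kolyvagin prime with `Frob = diag(1,−1)`)
and the swap takes `haF : FrobEqFrobInfty W K (2^(M+k)) a` (the KS margin class carries it).  P8, P4 (= (V44) margin one), τ-stability, P5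
(krr2-p2's signed auxiliary class) and T2 (`t = 0`, odd Tamagawa) are discharged exactly as in `…RTExactSwapHybrid`, whose standalone T2 lemma is
reused; P7a⁼/P7b⁼ are gk2-p3 g23's exact laws.  The two EXACT LOCAL LAWS are now THEOREMS (gk2-p3 g23: `swapPairing_pow_smul_ne_zero_at_two_exact` = hP7a, `swapPairing_pow_smul_eq_zero_at_two_exact`
= hP7b with the Frobenius binder; files `…RTExactSwapLawKummer` / `…RTExactSwapLawTransverse`) and are DISCHARGED here.  Displayed: Q2 by name, (NPh) at
level `2^(M+k)` — nothing else.  §Instantiated: `exactSwapAtTwo` (the frame BUILT INSIDE as in KRR `primeSwapAtTwoLossy_of_namedFacts`: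
`poitouTate_selmerStructure_duality_conj_holds`, `exists_weilDatum_liftAut_two_pow`, `exists_hybridTransverseFamily`) and **`deepSwap_socket`** = the
`hswap` binder of gk2-p2's `kolyvaginSuppliesAtTwo_of_deepSwap` (p727242) VERBATIM for the margin-`k` class `G q := L+k ≤ idx q ∧ FrobEqFrobInfty W K (2^(L+k)) q`
(`k ≥ 1`, `L ≥ 2M₀ + 12`), modulo Q2 + (NPh_{L+k}) ONLY.
References: [McCallumLMS1991] §5 Prop. 5.2 (proof), Lemma 5.3, Lemma 4.3; [Kolyvagin1991MathAnn] §2 Thm. 2.2; [Howard2004HeegnerKolyvagin] Lemma 2.7.3.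
-/

set_option autoImplicit false
set_option linter.dupNamespace false

noncomputable section

open scoped Classical Pointwise
open Function NumberField IsDedekindDomain WeierstrassCurve Field
open Literature.NumberTheory.EllipticCurves Literature.NumberTheory.GaloisRepresentations
open Literature.NumberTheory.EllipticCurves.Jetchev2008 Literature.NumberTheory.EllipticCurves.ModularForms
open Literature.NumberTheory.GaloisCohomology
open Literature.NumberTheory.GaloisRepresentations.DiscreteGaloisModule (localTatePairingZMod
  tateDual transverseSubgroup SelmerStructure)
open Literature.NumberTheory.Automorphic
open Summit.BirchSwinnertonDyer.Rank1Residual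
open Summit.BirchSwinnertonDyer.Rank1Residual.JET.SelmerVocabulary
open Summit.BirchSwinnertonDyer.Rank1Residual.JET.GlobalDuality
open Summit.BirchSwinnertonDyer.BirchSwinnertonDyer.Theses.GenusKolyvaginAtTwo (KolyvaginRelationAtTwo)
open Summit.BirchSwinnertonDyer.BirchSwinnertonDyer.Theorems.KolyvaginLowerBoundAtTwo

namespace Summit.BirchSwinnertonDyer.BirchSwinnertonDyer.Theorems.GenusExact.PlusDescent

section Frame

variable {K : Type} [Field K] [NumberField K] (W : WeierstrassCurve ℚ) [W.IsElliptic]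
  [W.IsGloballyMinimal] [(W.baseChange K).IsElliptic] [NeZero (W.conductorNorm ℤ)]
  [∀ M : ℕ, NeZero (2 ^ M)] [∀ M : ℕ, Finite (geomTorsion (W.baseChange K) ((2 ^ M : ℕ) : ℤ))]
  (τ : K ≃ₐ[ℚ] K)
  (Dt : ModularParametrizationData W (W.conductorNorm ℤ)) (β : ℤ) (ι : K →+* ℂ)
  [∀ j : ℕ, NumberField (ringClassField K ι j)]
  (e : ∀ M : ℕ, geomTorsion (W.baseChange K) ((2 ^ M : ℕ) : ℤ) →
    geomTorsion (W.baseChange K) ((2 ^ M : ℕ) : ℤ) → AlgebraicClosure K)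
  (hμ : ∀ M S T, e M S T ^ (2 ^ M) = 1)
  (hadd₁ : ∀ M S₁ S₂ T, e M (S₁ + S₂) T = e M S₁ T * e M S₂ T)
  (hadd₂ : ∀ M S T₁ T₂, e M S (T₁ + T₂) = e M S T₁ * e M S T₂)
  (hgal : ∀ M (g : absoluteGaloisGroup K) (S T : geomTorsion (W.baseChange K) ((2 ^ M : ℕ) : ℤ)),
    g • e M S T = e M (g • S) (g • T))
  (halt : ∀ M T, e M T T = 1) (hnondeg : ∀ M T, (∀ S, e M S T = 1) → T = 0)
  (hτe : ∀ (M : ℕ) S T, liftAut τ (e M S T) =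
    e M ((isLiftOfAut_liftAut τ).torsionMap W ((2 ^ M : ℕ) : ℤ) S)
      ((isLiftOfAut_liftAut τ).torsionMap W ((2 ^ M : ℕ) : ℤ) T))
  (inv : ∀ M : ℕ, LocalInvariants K (2 ^ M))
  (𝒯 : ∀ M : ℕ, SelmerStructure ((W.baseChange K).torsionGaloisModule ((2 ^ M : ℕ) : ℤ)))
  -- the habitat of LINE 18
  (hCM : ¬ W.HasCM) (hΔ : W.Δ < 0) (hTam : Odd W.tamagawaProduct)
  (hsur : ∀ m : ℕ, W.HasSurjectiveModNGaloisRep (2 ^ m : ℕ)) (hK : IsImaginaryQuadratic K)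
  (hodd : Odd (NumberField.discr K)) (hne3 : NumberField.discr K ≠ -3)
  (hns : ¬ IsSquare ((NumberField.discr K : ℚ) * -|W.Δ|))
  (hHN : SatisfiesHeegnerHypothesis (W.conductorNorm ℤ) K)
  (hτ1 : τ ≠ 1)
  (hperf : ∀ M, (inv M).IsPerfect) (hvan : ∀ M, (inv M).SumLocalTermEqZero)
  (hinvc : ∀ M, (inv M).IsConjCompatible τ) (hSC : ∀ M, (inv M).SelmerComplement)
  -- the hybrid transverse structures
  (hTko : ∀ (M : ℕ) (v : HeightOneSpectrum (𝓞 K)) (q : ℕ),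
    Zhang2014.IsKolyvaginPrime (W.conductorNorm ℤ) W K 2 q → M + 1 ≤ Zhang2014.kolyvaginIndex W 2 q →
    (q : 𝓞 K) ∈ v.asIdeal →
    𝒯 M (Sum.inr v) = ⨅ (w' : HeightOneSpectrum (𝓞 (ringClassField K ι q)))
        (_ : w'.asIdeal.LiesOver v.asIdeal),
        letI := (adicCompletionOfLiesOver K (ringClassField K ι q) v w').toAlgebra
        transverseSubgroup (GaloisRep.toLocal v ((W.baseChange K).torsionGaloisModule ((2 ^ M : ℕ) : ℤ)))
          (w'.adicCompletion (ringClassField K ι q)))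
  (hTku : ∀ (M : ℕ) (v : HeightOneSpectrum (𝓞 K)),
    (¬ ∃ q : ℕ, Zhang2014.IsKolyvaginPrime (W.conductorNorm ℤ) W K 2 q ∧
        M + 1 ≤ Zhang2014.kolyvaginIndex W 2 q ∧ (q : 𝓞 K) ∈ v.asIdeal) →
    𝒯 M (Sum.inr v) = (W.baseChange K).kummerSelmerStructure ((2 ^ M : ℕ) : ℤ) (Sum.inr v))
  (hQ2 : KolyvaginRelationAtTwo)

include hμ hadd₁ hadd₂ hgal halt hnondeg hτe hCM hΔ hTam hsur hK hodd hne3 hns hHN hτ1 hperf hvan hinvc hSC hTko hTku hQ2 in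
/-- **The exact prime swap at `2` on the HYBRID transverse frame — ALL local pieces discharged** (`exactSwap_core_frob` with P7a⁼/P7b⁼ = gk2-p3 g23's
`swapPairing_pow_smul_ne_zero_at_two_exact` / `swapPairing_pow_smul_eq_zero_at_two_exact`, P8 (`dualTransported_eq_of_hybrid`), P4
(`JET.localization_kolyvaginClass_mem_globalTransverse_two`, i.e. (V44) at margin one, unconditional), the `τ`-stability of the hybrid structure
(`JET.Walk.globalTransverse_conjActPlace_mem`), P5 (krr2-p2's signed auxiliary class `exists_auxClass_large_at_two`) and T2 with `t = 0`
(`kolyvaginClass_two_mem_selmerLocalKer_of_odd_tamagawaProduct`) DISCHARGED.  Conclusion = that of `exactSwap_core` plus the LEVEL-2 Gross condition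
`FrobEqFrobInfty W K 2 ℓ` of the fresh prime (gk2-p2's `adm` currency; `FrobEqFrobInfty.of_dvd`).
[cite: McCallumLMS1991, §5 Prop. 5.2 (proof), Lemma 5.3, Lemma 4.3] [cite: Howard2004HeegnerKolyvagin, Lemma 2.7.3] [cite: GrossLMS1991, Prop. 6.2] -/
theorem exactSwap_core_hybrid_frob {M k g n a : ℕ} (X : Finset ℕ) (dat : KolyvaginHeegnerData Dt β ι n)
    (hM : 12 ≤ M) (hk : 1 ≤ k) (hn : Squarefree n)
    (hnK : ∀ p ∈ n.primeFactors, Zhang2014.IsKolyvaginPrime (W.conductorNorm ℤ) W K 2 p ∧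
      M + 1 ≤ Zhang2014.kolyvaginIndex W 2 p)
    (ha : a ∈ n.primeFactors) (haF : FrobEqFrobInfty W K (2 ^ (M + k)) a)
    (hg : 1 ≤ g) (hord : addOrderOf (dat.kolyvaginClass Nat.prime_two M) = 2 ^ g)
    (hroom : M + 6 ≤ M / 2 + g)
    (hNPh : ∀ z : galH1Torsion (W.baseChange K) ((2 ^ (M + k) : ℕ) : ℤ),
      (∀ ρ ∈ torsionFixing (W.baseChange K) ((2 ^ (M + k) : ℕ) : ℤ),
        h1Eval (W.baseChange K) ((2 ^ (M + k) : ℕ) : ℤ) z ρ = 0) →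
      (∀ w : HeightOneSpectrum (𝓞 K), ((2 * W.conductorNorm ℤ : ℕ) : 𝓞 K) ∈ w.asIdeal →
        z ∈ selmerLocalKer (W.baseChange K) (w.adicCompletion K) ((2 ^ (M + k) : ℕ) : ℤ)) → z = 0) :
    ∃ ℓ : ℕ, ℓ ∉ X ∧ ℓ ∉ n.primeFactors ∧ Zhang2014.IsKolyvaginPrime (W.conductorNorm ℤ) W K 2 ℓ ∧
      M + k ≤ Zhang2014.kolyvaginIndex W 2 ℓ ∧ FrobEqFrobInfty W K (2 ^ (M + k)) ℓ ∧ FrobEqFrobInfty W K 2 ℓ ∧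
      (∀ v : HeightOneSpectrum (𝓞 K), ((ℓ : ℕ) : 𝓞 K) ∈ v.asIdeal →
        ((2 ^ (g - 1) : ℕ) : ℤ) • dat.kolyvaginClass Nat.prime_two M ∉
          (W.baseChange K).torsionLocalKer (v.adicCompletion K) ((2 ^ M : ℕ) : ℤ)) ∧
      ∃ dat' : KolyvaginHeegnerData Dt β ι (n / a * ℓ),
        ((2 ^ (g - 1) : ℕ) : ℤ) • dat'.kolyvaginClass Nat.prime_two M ≠ 0 := by
  classical
  haveI : Fact (Nat.Prime 2) := ⟨Nat.prime_two⟩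
  have hne4 : NumberField.discr K ≠ -4 := fun h ↦ by
    rw [h] at hodd; have := Int.odd_iff.mp hodd; omega
  have hD : NumberField.discr K < -4 := IsImaginaryQuadratic.discr_lt_neg_four_of_odd hK hodd hne3
  have hττ : τ * τ = 1 := mul_self_eq_one_of_isImaginaryQuadratic hK τ
  have hinj : ∀ (M : ℕ) (v : HeightOneSpectrum (𝓞 K)), Injective (inv M (Sum.inr v)) :=
    fun M v ↦ ((hperf M) v).1.injective
  -- P8: self-duality of the hybrid structure at every finite place
  have h𝒯sd : ∀ (M c : ℕ), ∀ v ∈ placesDividing K c,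
      (inv M).dualTransported (𝒯 M) (weilDualIntertwining (W.baseChange K) (2 ^ M) (e M) (hμ M) (hadd₁ M)
        (hadd₂ M) (hgal M)) (Sum.inr v) = 𝒯 M (Sum.inr v) := fun M c ↦
    dualTransported_eq_of_hybrid W M (e M) (hμ M) (hadd₁ M) (hadd₂ M) (hgal M) (halt M) (hnondeg M) (inv M)
      (𝒯 M) hK hD ι (hinj M) (fun v ↦ by
        by_cases h : ∃ q : ℕ, Zhang2014.IsKolyvaginPrime (W.conductorNorm ℤ) W K 2 q ∧
            M + 1 ≤ Zhang2014.kolyvaginIndex W 2 q ∧ (q : 𝓞 K) ∈ v.asIdeal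
        · obtain ⟨q, hq, hMq, hqv⟩ := h
          exact Or.inl ⟨q, hq, hMq, hqv, hTko M v q hq hMq hqv⟩
        · exact Or.inr (hTku M v h)) c
  -- P4: transversality at the primes of the conductor — (V44) at margin one, unconditional at 2
  have hP4 : ∀ (M c : ℕ) (dat : KolyvaginHeegnerData Dt β ι c),
      KolyvaginDescent.KolSupp (Zhang2014.IsKolyvaginPrime (W.conductorNorm ℤ) W K 2) c → 1 ≤ M →
      (∀ q ∈ c.primeFactors, M + 1 ≤ Zhang2014.kolyvaginIndex W 2 q) →
      ∀ w ∈ placesDividing K c,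
        galoisCohomology.localization ((W.baseChange K).torsionGaloisModule ((2 ^ M : ℕ) : ℤ)) (Sum.inr w) 1
          (dat.kolyvaginClass Nat.prime_two M) ∈ 𝒯 M (Sum.inr w) := by
    intro M c dat hc _ hcM w hw
    obtain ⟨𝒯g, h𝒯g, -⟩ := JET.Walk.exists_globalTransverseFamily W ι ((2 ^ M : ℕ) : ℤ)
    have hmem := JET.localization_kolyvaginClass_mem_globalTransverse_two W hK hD Dt β ι M h𝒯g dat hc hcM w hw
    obtain ⟨q, hqc, hqw⟩ := (natCast_mem_iff_exists_primeFactor_mem hc.1.ne_zero w).mp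
      ((mem_placesDividing_iff_natCast_mem hc.1.ne_zero w).mp hw)
    rw [hTko M w q (hc.2 q hqc) (hcM q hqc) hqw, ← JET.Walk.globalTransverse_eq_of_natCast_mem h𝒯g w
      (Nat.prime_of_mem_primeFactors hqc) hqw]
    exact hmem
  -- τ-stability of the hybrid structure at the places of a Kolyvagin conductor
  have h𝒯σ : ∀ (M m : ℕ), KolyvaginDescent.KolSupp (Zhang2014.IsKolyvaginPrime (W.conductorNorm ℤ) W K 2) m →
      (∀ q ∈ m.primeFactors, M + 1 ≤ Zhang2014.kolyvaginIndex W 2 q) →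
      ∀ (v w : HeightOneSpectrum (𝓞 K)) (h : τ • v = w), v ∈ placesDividing K m →
      ∀ x : galoisCohomology (((W.baseChange K).torsionGaloisModule ((2 ^ M : ℕ) : ℤ)).toLocal
        (Sum.inr v : Place K)) 1, x ∈ 𝒯 M (Sum.inr v) → conjActPlace W τ ((2 ^ M : ℕ) : ℤ) h x ∈ 𝒯 M (Sum.inr w) := by
    intro M m hm hmidx v w h hv x hx
    obtain ⟨𝒯g, h𝒯g, -⟩ := JET.Walk.exists_globalTransverseFamily W ι ((2 ^ M : ℕ) : ℤ)
    obtain ⟨q, hqm, hqv⟩ := (natCast_mem_iff_exists_primeFactor_mem hm.1.ne_zero v).mp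
      ((mem_placesDividing_iff_natCast_mem hm.1.ne_zero v).mp hv)
    have hq := hm.2 q hqm
    have hvv : τ • v = v := smul_place_eq_self_of_natCast_mem τ hq.1.ne_zero hq.2.2.2.2.1 v hqv
    have hvw : v = w := hvv.symm.trans h
    subst hvw
    have heq : 𝒯 M (Sum.inr v) = 𝒯g (Sum.inr v) := by
      rw [hTko M v q hq (hmidx q hqm) hqv, JET.Walk.globalTransverse_eq_of_natCast_mem h𝒯g v hq.1 hqv]
    rw [heq] at hx ⊢
    exact JET.Walk.globalTransverse_conjActPlace_mem h𝒯g τ hm.1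
      (JET.forall_conjActPlace_mem_of_eq_iInf_transverseSubgroup W hK ι τ _ m) v v h hv x hx
  -- P5: krr2-p2's SIGNED auxiliary class with size on the hybrid structure (M ≥ 9)
  have hP5 : ∀ (M m a : ℕ) (v₀ : HeightOneSpectrum (𝓞 K)) (s : ℤ), (s = 1 ∨ s = -1) → 9 ≤ M →
      KolyvaginDescent.KolSupp (Zhang2014.IsKolyvaginPrime (W.conductorNorm ℤ) W K 2) m →
      (∀ q ∈ m.primeFactors, M + 1 ≤ Zhang2014.kolyvaginIndex W 2 q) →
      Zhang2014.IsKolyvaginPrime (W.conductorNorm ℤ) W K 2 a → M + 1 ≤ Zhang2014.kolyvaginIndex W 2 a →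
      ¬ a ∣ m → ((a : ℕ) : 𝓞 K) ∈ v₀.asIdeal →
      ∃ w : galoisCohomology ((W.baseChange K).torsionGaloisModule ((2 ^ M : ℕ) : ℤ)) 1,
        w ∈ signPart W K τ ((2 ^ M : ℕ) : ℤ) s
          (((selmerF W ((2 ^ M : ℕ) : ℤ) (𝒯 M) (placesDividing K m)).relaxedAt {v₀}).selmerGroup) ∧
        ((2 ^ (M / 2 - 5) : ℕ) : ℤ) • w ≠ 0 := by
    intro M m a v₀ s hs hM9 hm hmidx ha hMa ham hv₀
    have hfix : τ • v₀ = v₀ := smul_place_eq_self_of_natCast_mem τ ha.1.ne_zero ha.2.2.2.2.1 v₀ hv₀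
    have hτe' : ∀ S T, liftAutPlace τ hfix (e M S T) =
        e M ((isLiftOfAut_liftAutPlace τ hfix).torsionMap W ((2 ^ M : ℕ) : ℤ) S)
          ((isLiftOfAut_liftAutPlace τ hfix).torsionMap W ((2 ^ M : ℕ) : ℤ) T) := fun S T ↦
      weil_equivariant_of_isLiftOfAut W ((2 ^ M : ℕ) : ℤ) (isLiftOfAut_liftAutPlace τ hfix) (isLiftOfAut_liftAut τ)
        (e M) (hgal M) (hτe M) S T
    exact exists_auxClass_large_at_two W τ M (e M) (hμ M) (hadd₁ M) (hadd₂ M) (hgal M) (halt M) (hnondeg M) (inv M)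
      (𝒯 M) hK hτ1 hττ (hperf M) (hvan M) (hSC M) (hinvc M) hM9 hm.1.ne_zero (h𝒯sd M m)
      (h𝒯σ M m hm hmidx) ha hMa ham v₀ hv₀ hfix hτe' hs
  -- P7a⁼ / P7b⁼: gk2-p3 g23's exact local laws (cyclic eigenlines on Δ < 0; the Frobenius binder on the swapped-out prime is necessary)
  have hP7a := swapPairing_pow_smul_ne_zero_at_two_exact (W := W) (τ := τ) (e := e) (hμ := hμ) (hadd₁ := hadd₁) (hadd₂ := hadd₂)
    (hgal := hgal) (halt := halt) (hnondeg := hnondeg) (inv := inv) hK hΔ hτ1 hττ hτe hinj hinvc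
  have hP7b := swapPairing_pow_smul_eq_zero_at_two_exact (W := W) (τ := τ) (ι := ι) (e := e) (hμ := hμ) (hadd₁ := hadd₁) (hadd₂ := hadd₂)
    (hgal := hgal) (halt := halt) (hnondeg := hnondeg) (inv := inv) (𝒯 := 𝒯) hK hD hΔ hτ1 hττ hτe hperf hinvc hTko
  -- T2 with t = 0: Gross 6.2(1) / McCallum 4.3 at 2 on the odd-Tamagawa habitat
  have hT2 := pow_zero_zsmul_kolyvaginClass_two_mem_selmerLocalKer_of_odd_tamagawaProduct W hsur hTam hK hne3 hne4 hHN Dt β ι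
  obtain ⟨ℓ, hℓX, hℓn, hKol, hidx, hfrob, hdet, d', hd'⟩ := exactSwap_core_frob (W := W) (τ := τ) (Dt := Dt) (β := β) (ι := ι)
    (e := e) (hμ := hμ) (hadd₁ := hadd₁) (hadd₂ := hadd₂) (hgal := hgal) (halt := halt) (hnondeg := hnondeg) (inv := inv) (𝒯 := 𝒯)
    (hCM := hCM) (hΔ := hΔ) (hsur := hsur) (hK := hK) (hodd := hodd) (hne3 := hne3) (hns := hns) (hHN := hHN) (hτ1 := hτ1)
    (hperf := hperf) (hvan := hvan) (h𝒯sd := h𝒯sd) (hP4 := hP4) (hP5 := hP5) (hP7a := hP7a) (hP7b := hP7b)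
    (hQ2 := hQ2) (hT2 := hT2) X dat hM hk hn hnK ha haF hg hord hroom hNPh
  exact ⟨ℓ, hℓX, hℓn, hKol, hidx, hfrob, hfrob.of_dvd (dvd_pow_self 2 (by omega)), hdet, d', hd'⟩

end Frame

/-! ## The frame instantiated: the swap in pure Kolyvagin-datum currency, and gk2-p2's `hswap` socket -/

section Instantiated

variable {K : Type} [Field K] [NumberField K] (W : WeierstrassCurve ℚ) [W.IsElliptic] [W.IsGloballyMinimal] [NeZero (W.conductorNorm ℤ)]

/-- **THE EXACT PRIME SWAP AT `2`, frame instantiated, UNCONDITIONAL up to Q2 and (NPh)** (gk2-p2's `hswap` socket with margin `k`, in pure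
Kolyvagin-datum currency).  [cite: McCallumLMS1991, §5 Prop. 5.2 (proof), Lemma 5.3] [cite: Kolyvagin1991MathAnn, §2 Thm. 2.2] -/
theorem exactSwapAtTwo (hCM : ¬ W.HasCM) (hΔ : W.Δ < 0) (hTam : Odd W.tamagawaProduct)
    (hsur : ∀ m : ℕ, W.HasSurjectiveModNGaloisRep (2 ^ m : ℕ)) (hK : IsImaginaryQuadratic K)
    (hodd : Odd (NumberField.discr K)) (hne3 : NumberField.discr K ≠ -3)
    (hns : ¬ IsSquare ((NumberField.discr K : ℚ) * -|W.Δ|))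
    (hHN : SatisfiesHeegnerHypothesis (W.conductorNorm ℤ) K) (τ : K ≃ₐ[ℚ] K) (hτ1 : τ ≠ 1)
    (Dt : ModularParametrizationData W (W.conductorNorm ℤ)) (β : ℤ) (ι : K →+* ℂ)
    (hQ2 : KolyvaginRelationAtTwo)
    {M k g n a : ℕ} (X : Finset ℕ) (dat : KolyvaginHeegnerData Dt β ι n)
    (hM : 12 ≤ M) (hk : 1 ≤ k) (hn : Squarefree n)
    (hnK : ∀ p ∈ n.primeFactors, Zhang2014.IsKolyvaginPrime (W.conductorNorm ℤ) W K 2 p ∧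
      M + 1 ≤ Zhang2014.kolyvaginIndex W 2 p)
    (ha : a ∈ n.primeFactors) (haF : FrobEqFrobInfty W K (2 ^ (M + k)) a)
    (hg : 1 ≤ g) (hord : addOrderOf (dat.kolyvaginClass Nat.prime_two M) = 2 ^ g)
    (hroom : M + 6 ≤ M / 2 + g)
    (hNPh : ∀ z : galH1Torsion (W.baseChange K) ((2 ^ (M + k) : ℕ) : ℤ),
      (∀ ρ ∈ torsionFixing (W.baseChange K) ((2 ^ (M + k) : ℕ) : ℤ),
        h1Eval (W.baseChange K) ((2 ^ (M + k) : ℕ) : ℤ) z ρ = 0) →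
      (∀ w : HeightOneSpectrum (𝓞 K), ((2 * W.conductorNorm ℤ : ℕ) : 𝓞 K) ∈ w.asIdeal →
        z ∈ selmerLocalKer (W.baseChange K) (w.adicCompletion K) ((2 ^ (M + k) : ℕ) : ℤ)) → z = 0) :
    ∃ ℓ : ℕ, ℓ ∉ X ∧ ℓ ∉ n.primeFactors ∧ Zhang2014.IsKolyvaginPrime (W.conductorNorm ℤ) W K 2 ℓ ∧
      M + k ≤ Zhang2014.kolyvaginIndex W 2 ℓ ∧ FrobEqFrobInfty W K (2 ^ (M + k)) ℓ ∧ FrobEqFrobInfty W K 2 ℓ ∧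
      (∀ v : HeightOneSpectrum (𝓞 K), ((ℓ : ℕ) : 𝓞 K) ∈ v.asIdeal →
        ((2 ^ (g - 1) : ℕ) : ℤ) • dat.kolyvaginClass Nat.prime_two M ∉
          (W.baseChange K).torsionLocalKer (v.adicCompletion K) ((2 ^ M : ℕ) : ℤ)) ∧
      ∃ dat' : KolyvaginHeegnerData Dt β ι (n / a * ℓ),
        ((2 ^ (g - 1) : ℕ) : ℤ) • dat'.kolyvaginClass Nat.prime_two M ≠ 0 := by
  classical
  haveI : Fact (Nat.Prime 2) := ⟨Nat.prime_two⟩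
  haveI : ∀ j : ℕ, NumberField (ringClassField K ι j) := JET.numberField_ringClassField K hK ι
  haveI : (W.baseChange K).IsElliptic := by rw [baseChange]; infer_instance
  haveI hNZ : ∀ M : ℕ, NeZero (2 ^ M) := fun M ↦ ⟨pow_ne_zero M two_ne_zero⟩
  haveI : ∀ M : ℕ, Finite (geomTorsion (W.baseChange K) ((2 ^ M : ℕ) : ℤ)) := fun M ↦
    finite_geomTorsion_of_neZero (W.baseChange K) (2 ^ M)
  -- the frame, per level: Poitou–Tate families, Weil data, hybrid structures
  have hinv : ∀ M : ℕ, ∃ inv : LocalInvariants K (2 ^ M), inv.IsPerfect ∧ inv.SumLocalTermEqZero ∧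
      inv.UnramifiedOrthogonal ∧ inv.SelmerComplement ∧ ∀ σ : K ≃ₐ[ℚ] K, inv.IsConjCompatible σ :=
    fun M ↦ InputsPoitouTateSelmer.poitouTate_selmerStructure_duality_conj_holds K (2 ^ M)
  choose inv hperf hvan hUO hSC hconj using hinv
  have hweil := fun M : ℕ ↦ exists_weilDatum_liftAut_two_pow (K := K) W τ M
  choose e hμ hadd₁ hadd₂ hgal halt hnondeg hτe using hweil
  have hhyb := fun M : ℕ ↦ exists_hybridTransverseFamily (K := K) W ι M
  choose 𝒯 hTko hTku using hhyb
  exact exactSwap_core_hybrid_frob (W := W) (τ := τ) (Dt := Dt) (β := β) (ι := ι) (e := e) (hμ := hμ) (hadd₁ := hadd₁)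
    (hadd₂ := hadd₂) (hgal := hgal) (halt := halt) (hnondeg := hnondeg) (hτe := hτe) (inv := inv) (𝒯 := 𝒯) (hCM := hCM)
    (hΔ := hΔ) (hTam := hTam) (hsur := hsur) (hK := hK) (hodd := hodd) (hne3 := hne3) (hns := hns) (hHN := hHN) (hτ1 := hτ1)
    (hperf := hperf) (hvan := hvan) (hinvc := fun M ↦ hconj M τ) (hSC := hSC) (hTko := hTko) (hTku := hTku)
    (hQ2 := hQ2) X dat hM hk hn hnK ha haF hg hord hroom hNPh

/-- **gk2-p2's `hswap` socket, VERBATIM, modulo Q2 + (NPh)** (the `hswap` binder of `kolyvaginSuppliesAtTwo_of_deepSwap`, p727242,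
for the margin-`k` class `G q := L + k ≤ index q ∧ FrobEqFrobInfty W K (2^(L+k)) q`, `k ≥ 1`, level `L ≥ 2M₀ + 12`): for `r ≥ 1`, `m < M₀`,
every depth-`r` level `n` in the class with `addOrderOf c_L(n) = 2^(L−m)` and every `ℓ₀ ∣ n` admit a fresh `ℓ′` in the class outside any finite
`X`, at whose place `2^(L−m−1) c_L(n)` is locally non-zero, and a datum at `ℓ′·(n/ℓ₀)` with `2^(L−m−1) • c_L ≠ 0` — `exactSwapAtTwo`
with `M := L`, `g := L − m`, `a := ℓ₀` (the minimality premise of the socket is not even used).  Displayed: Q2, (NPh_{L+k}) in the robust `2N`-form.  [cite: McCallumLMS1991, §5 Prop. 5.2 (proof)] [cite: Kolyvagin1991MathAnn, §2 Thm. 2.2] -/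
theorem deepSwap_socket (hCM : ¬ W.HasCM) (hΔ : W.Δ < 0) (hTam : Odd W.tamagawaProduct)
    (hsur : ∀ m : ℕ, W.HasSurjectiveModNGaloisRep (2 ^ m : ℕ)) (hK : IsImaginaryQuadratic K)
    (hodd : Odd (NumberField.discr K)) (hne3 : NumberField.discr K ≠ -3)
    (hns : ¬ IsSquare ((NumberField.discr K : ℚ) * -|W.Δ|))
    (hHN : SatisfiesHeegnerHypothesis (W.conductorNorm ℤ) K) (τ : K ≃ₐ[ℚ] K) (hτ1 : τ ≠ 1)
    (Dt : ModularParametrizationData W (W.conductorNorm ℤ)) (β : ℤ) (ι : K →+* ℂ)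
    (hQ2 : KolyvaginRelationAtTwo)
    {M₀ L k : ℕ} (hL : 2 * M₀ + 12 ≤ L) (hk : 1 ≤ k)
    (hNPh : ∀ z : galH1Torsion (W.baseChange K) ((2 ^ (L + k) : ℕ) : ℤ),
      (∀ ρ ∈ torsionFixing (W.baseChange K) ((2 ^ (L + k) : ℕ) : ℤ),
        h1Eval (W.baseChange K) ((2 ^ (L + k) : ℕ) : ℤ) z ρ = 0) →
      (∀ w : HeightOneSpectrum (𝓞 K), ((2 * W.conductorNorm ℤ : ℕ) : 𝓞 K) ∈ w.asIdeal →
        z ∈ selmerLocalKer (W.baseChange K) (w.adicCompletion K) ((2 ^ (L + k) : ℕ) : ℤ)) → z = 0) :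
    ∀ (r m : ℕ), 1 ≤ r → m < M₀ →
      (∀ (n : ℕ) (e : KolyvaginHeegnerData Dt β ι n), Squarefree n → n.primeFactors.card = r →
        (∀ q ∈ n.primeFactors, (Zhang2014.IsKolyvaginPrime (W.conductorNorm ℤ) W K 2 q ∧ L ≤ Zhang2014.kolyvaginIndex W 2 q) ∧
          (L + k ≤ Zhang2014.kolyvaginIndex W 2 q ∧ FrobEqFrobInfty W K (2 ^ (L + k)) q)) →
        ((2 ^ (L - m) : ℕ) : ℤ) • e.kolyvaginClass Nat.prime_two L = 0) →
      ∀ (n : ℕ) (d : KolyvaginHeegnerData Dt β ι n), Squarefree n → n.primeFactors.card = r →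
      (∀ q ∈ n.primeFactors, (Zhang2014.IsKolyvaginPrime (W.conductorNorm ℤ) W K 2 q ∧ L ≤ Zhang2014.kolyvaginIndex W 2 q) ∧
        (L + k ≤ Zhang2014.kolyvaginIndex W 2 q ∧ FrobEqFrobInfty W K (2 ^ (L + k)) q)) →
      addOrderOf (d.kolyvaginClass Nat.prime_two L) = 2 ^ (L - m) →
      ∀ ℓ₀ ∈ n.primeFactors, ∀ X : Finset ℕ, ∃ ℓ' : ℕ, ℓ' ∉ X ∧ ℓ' ∉ n.primeFactors ∧
        ((Zhang2014.IsKolyvaginPrime (W.conductorNorm ℤ) W K 2 ℓ' ∧ L ≤ Zhang2014.kolyvaginIndex W 2 ℓ') ∧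
          (L + k ≤ Zhang2014.kolyvaginIndex W 2 ℓ' ∧ FrobEqFrobInfty W K (2 ^ (L + k)) ℓ')) ∧
        (∃ v : HeightOneSpectrum (𝓞 K), ((ℓ' : ℕ) : 𝓞 K) ∈ v.asIdeal ∧
          ((2 ^ (L - m - 1) : ℕ) : ℤ) • d.kolyvaginClass Nat.prime_two L ∉
            (W.baseChange K).torsionLocalKer (v.adicCompletion K) ((2 ^ L : ℕ) : ℤ)) ∧
        ∃ d' : KolyvaginHeegnerData Dt β ι (ℓ' * (n / ℓ₀)),
          ((2 ^ (L - m - 1) : ℕ) : ℤ) • d'.kolyvaginClass Nat.prime_two L ≠ 0 := by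
  intro r m _ hm _ n d hn _ hadm hord ℓ₀ hℓ₀ X
  have hnK : ∀ p ∈ n.primeFactors, Zhang2014.IsKolyvaginPrime (W.conductorNorm ℤ) W K 2 p ∧
      L + 1 ≤ Zhang2014.kolyvaginIndex W 2 p := fun p hp ↦ ⟨(hadm p hp).1.1, le_trans (by omega) (hadm p hp).2.1⟩
  obtain ⟨ℓ, hℓX, hℓn, hKol, hidx, hfrob, -, hdet, d', hd'⟩ := exactSwapAtTwo W hCM hΔ hTam hsur hK hodd hne3 hns hHN τ hτ1
    Dt β ι hQ2 (M := L) (k := k) (g := L - m) X d (by omega) hk hn hnK hℓ₀ (hadm ℓ₀ hℓ₀).2.2 (by omega) hord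
    (by omega) hNPh
  have hℓp : ℓ.Prime := hKol.1
  obtain ⟨v, hv⟩ : ∃ v : HeightOneSpectrum (𝓞 K), ((ℓ : ℕ) : 𝓞 K) ∈ v.asIdeal :=
    ⟨⟨Ideal.span {((ℓ : ℕ) : 𝓞 K)}, hKol.2.2.2.2.1, by
        rw [Ne, Ideal.span_singleton_eq_bot]; exact_mod_cast hℓp.ne_zero⟩,
      Ideal.mem_span_singleton_self _⟩
  have hcast : n / ℓ₀ * ℓ = ℓ * (n / ℓ₀) := Nat.mul_comm _ _
  refine ⟨ℓ, hℓX, hℓn, ⟨⟨hKol, le_trans (Nat.le_add_right L k) hidx⟩, hidx, hfrob⟩,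
    ⟨v, hv, hdet v hv⟩, hcast ▸ d', ?_⟩
  rw [kolyvaginClass_cast_swap hcast d' L]
  exact hd'

end Instantiated

end Summit.BirchSwinnertonDyer.BirchSwinnertonDyer.Theorems.GenusExact.PlusDescent

end
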